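import Summits.QuantumAdvantage.QuantumAdvantage.Theses.SpinorFlattening
import Literature.Computability.QuantumComplexity.GaussianRank

/-!
# `FlatteningBoundRobust` (stmt-QuantumAdvantage-1246) — negative side III: HOW MANY of the `n = 4t`
# annihilators are load-bearing?  `n − 4` do NOT suffice.

Sorry-free, definition-free negative lemma for the crux `SpinorFlattening.FlatteningBoundRobust`
(route QuantumAdvantage/SpinorFlattening, rank 3), from the standing disprover's work file
`Cruxes/FlatteningBoundRobust/Disproof.lean` §J (refuter-cdisprove-stmt-QuantumAdvantage-1246-g2-0,
2026-08-16).  Nothing here asserts a Theses declaration positively.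

The item's dictionary asks for `n` (= number of qubits) independent annihilating Majorana combinations.
Generation 1 showed that dropping the annihilation requirement altogether (`A = 0`, or no Gaussianity)
breaks the crux at `t = 1`.  Here: keeping `n − 4` GENUINE independent annihilators per term still
breaks it, at `(t,K,r) = (2,2,2)` (count `2·D_2(8) = 58 < 64 = C(2,2)·8²`):
`|M⟩⊗|M⟩ = (√2)⁻¹ ψ_false + (√2)⁻¹ ψ_true`, `ψ_c = |c c c c⟩ ⊗ |M⟩ = (√2)⁻¹(|c⁴0⁴⟩ + |c⁴1⁴⟩)`, each
annihilated by the four one-mode annihilators `c_{k,X} + i(−1)^c c_{k,Y}` (`k` in block 0) — a state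
Gaussian on block 0 and magic on block 1.  So the deficiency step must use more than `n − 4` of the
annihilators; informally `n − 3` suffice modulo the crux (all half-spinors in `≤ 3` modes are pure, so
the parity components of an `(n−k)`-annihilated vector, `k ≤ 3`, are Gaussian): the obstruction is
local to ONE magic block.  By-product: `modeAnnihilator_basisState`, the one-mode annihilator of a
computational basis state, as a reusable lemma.
-/

noncomputable section

set_option linter.dupNamespace false -- D-0017: single-conjunct summit ⇒ `QuantumAdvantage.QuantumAdvantage` by design

namespace Summit.QuantumAdvantage.QuantumAdvantage.Theorems.FlatteningBoundRobust.Negative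

open Matrix Finset
open Literature.Computability.QuantumComplexity Literature.Computability.Cryptography

/-- THE ONE-MODE ANNIHILATOR OF A BASIS STATE: `(c_{k,X} + i (−1)^{x_k} c_{k,Y}) |x⟩ = 0`
(`2 a_k` on an empty mode, `2 a_k†` on a full one). [cite: DiasKoenig2024, §2.1 (a_j |0_F⟩ = 0, eq. (11))] -/
theorem modeAnnihilator_basisState {n : ℕ} (x : QReg n) (k : Fin n) :
    (majorana n k false + (if x k then -Complex.I else Complex.I) • majorana n k true) *ᵥ
      basisState x = 0 := by
  rw [Matrix.add_mulVec, Matrix.smul_mulVec]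
  funext y
  simp only [Pi.add_apply, Pi.smul_apply, Pi.zero_apply, smul_eq_mul, basisState,
    Matrix.mulVec_single_one, Matrix.col_apply, majorana_apply]
  cases x k <;> cases y k <;> simp <;> ring_nf <;> simp [Complex.I_sq]

/-- The four annihilator vectors of `ψ_c` are linearly independent. [folklore] -/
theorem witness_annihilators_linearIndependent (c : Bool) : LinearIndependent ℂ (fun (k : Fin 4) (p : Fin (2 * 4) × Bool) => if p.1 = finProdFinEquiv ((0 : Fin 2), k) then (if p.2 then (if (c : Bool) then -Complex.I else Complex.I) else (1 : ℂ)) else 0) := by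
  rw [Fintype.linearIndependent_iff]
  intro g hg k
  have h := congrFun hg (finProdFinEquiv ((0 : Fin 2), k), false)
  simp only [Finset.sum_apply, Pi.smul_apply, smul_eq_mul, Pi.zero_apply] at h
  rw [Finset.sum_eq_single k] at h
  · simpa using h
  · intro k' _ hk'
    rw [if_neg, mul_zero]
    intro e
    exact hk' (Prod.mk.inj (finProdFinEquiv.injective e)).2.symm
  · simp

/-- The annihilating combination of `(fun (k : Fin 4) (p : Fin (2 * 4) × Bool) => if p.1 = finProdFinEquiv ((0 : Fin 2), k) then (if p.2 then (if (c : Bool) then -Complex.I else Complex.I) else (1 : ℂ)) else 0) k` is `c_{w,X} + i(−1)^c c_{w,Y}`, `w` = wire `k` of block 0.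
[folklore] -/
theorem witness_annihilator_sum (c : Bool) (k : Fin 4) :
    (∑ p : Fin (2 * 4) × Bool, (fun (k : Fin 4) (p : Fin (2 * 4) × Bool) => if p.1 = finProdFinEquiv ((0 : Fin 2), k) then (if p.2 then (if (c : Bool) then -Complex.I else Complex.I) else (1 : ℂ)) else 0) k p • majorana (2 * 4) p.1 p.2) =
      majorana (2 * 4) (finProdFinEquiv ((0 : Fin 2), k)) false +
        (if c then -Complex.I else Complex.I) • majorana (2 * 4) (finProdFinEquiv ((0 : Fin 2), k)) true := by
  rw [Fintype.sum_prod_type, Finset.sum_eq_single (finProdFinEquiv ((0 : Fin 2), k))]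
  · simp [add_comm]
  · intro j _ hj
    simp [hj]
  · simp

/-- `ψ_c` is annihilated by its four one-mode annihilators (both basis strings have bit `c` on block 0).
[folklore] -/
theorem witness_annihilates (c : Bool) (k : Fin 4) :
    (∑ p : Fin (2 * 4) × Bool, (fun (k : Fin 4) (p : Fin (2 * 4) × Bool) => if p.1 = finProdFinEquiv ((0 : Fin 2), k) then (if p.2 then (if (c : Bool) then -Complex.I else Complex.I) else (1 : ℂ)) else 0) k p • majorana (2 * 4) p.1 p.2) *ᵥ ((Real.sqrt 2 : ℂ)⁻¹ • ((basisState (fun w : Fin (2 * 4) => ((![c, false]) : Fin 2 → Bool) (finProdFinEquiv.symm w).1) : QReg (2 * 4) → ℂ) + basisState (fun w : Fin (2 * 4) => ((![c, true]) : Fin 2 → Bool) (finProdFinEquiv.symm w).1))) = 0 := by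
  rw [witness_annihilator_sum, Matrix.mulVec_smul, Matrix.mulVec_add]
  have h1 := modeAnnihilator_basisState ((fun w : Fin (2 * 4) => ((![c, false]) : Fin 2 → Bool) (finProdFinEquiv.symm w).1)) (finProdFinEquiv ((0 : Fin 2), k))
  have h2 := modeAnnihilator_basisState ((fun w : Fin (2 * 4) => ((![c, true]) : Fin 2 → Bool) (finProdFinEquiv.symm w).1)) (finProdFinEquiv ((0 : Fin 2), k))
  simp only [Equiv.symm_apply_apply, Matrix.cons_val_zero] at h1 h2
  rw [h1, h2, add_zero, smul_zero]

/-- `ψ_c ≠ 0`. [folklore] -/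
theorem witness_ne_zero (c : Bool) : ((Real.sqrt 2 : ℂ)⁻¹ • ((basisState (fun w : Fin (2 * 4) => ((![c, false]) : Fin 2 → Bool) (finProdFinEquiv.symm w).1) : QReg (2 * 4) → ℂ) + basisState (fun w : Fin (2 * 4) => ((![c, true]) : Fin 2 → Bool) (finProdFinEquiv.symm w).1))) ≠ 0 := by
  intro h
  have := congrFun h (fun w : Fin (2 * 4) => ((![c, false]) : Fin 2 → Bool) (finProdFinEquiv.symm w).1)
  have hne : (fun w : Fin (2 * 4) => ((![c, false]) : Fin 2 → Bool) (finProdFinEquiv.symm w).1) ≠ (fun w : Fin (2 * 4) => ((![c, true]) : Fin 2 → Bool) (finProdFinEquiv.symm w).1) := by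
    intro e
    have := congrFun e (finProdFinEquiv ((1 : Fin 2), (0 : Fin 4)))
    simp at this
  simp only [Pi.smul_apply, Pi.add_apply, Pi.zero_apply, basisState_apply, if_neg hne,
    smul_eq_mul] at this
  norm_num at this

/-- `|M⟩ ⊗ |M⟩ = (√2)⁻¹ ψ_false + (√2)⁻¹ ψ_true`, in the crux's own shape. [folklore] -/
theorem magicMPow_two_eq_sum_witness :
    magicMPow 2 = ∑ i : Fin 2, (![(Real.sqrt 2 : ℂ)⁻¹, (Real.sqrt 2 : ℂ)⁻¹] i) •
      ((![((Real.sqrt 2 : ℂ)⁻¹ • ((basisState (fun w : Fin (2 * 4) => ((![false, false]) : Fin 2 → Bool) (finProdFinEquiv.symm w).1) : QReg (2 * 4) → ℂ) + basisState (fun w : Fin (2 * 4) => ((![false, true]) : Fin 2 → Bool) (finProdFinEquiv.symm w).1))), ((Real.sqrt 2 : ℂ)⁻¹ • ((basisState (fun w : Fin (2 * 4) => ((![true, false]) : Fin 2 → Bool) (finProdFinEquiv.symm w).1) : QReg (2 * 4) → ℂ) + basisState (fun w : Fin (2 * 4) => ((![true, true]) : Fin 2 → Bool) (finProdFinEquiv.symm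 w).1)))] : Fin 2 → QReg (2 * 4) → ℂ) i) := by
  have hbs : magicMPow 2 = ∑ b : Fin 2 → Bool, (((Real.sqrt 2 : ℂ)⁻¹) ^ 2) •
      basisState (fun w : Fin (2 * 4) => b (finProdFinEquiv.symm w).1) := by
    classical
    funext x
    simp only [Finset.sum_apply, Pi.smul_apply, basisState_apply, smul_eq_mul, mul_ite, mul_one,
      mul_zero]
    by_cases hP : ∀ k : Fin 2, ∀ i : Fin 4,
        x (finProdFinEquiv (k, i)) = x (finProdFinEquiv (k, (0 : Fin 4)))
    · rw [magicMPow_apply, if_pos hP]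
      rw [Finset.sum_eq_single (fun k => x (finProdFinEquiv (k, (0 : Fin 4))))]
      · rw [if_pos]
        funext w
        obtain ⟨⟨k, i⟩, rfl⟩ := finProdFinEquiv.surjective w
        simp only [Equiv.symm_apply_apply]
        exact hP k i
      · intro b _ hb
        rw [if_neg]
        intro hx
        apply hb
        funext k
        have := congrFun hx (finProdFinEquiv (k, (0 : Fin 4)))
        simp only [Equiv.symm_apply_apply] at this
        exact this.symm
      · intro h
        exact absurd (Finset.mem_univ _) h
    · rw [magicMPow_apply, if_neg hP]
      symm
      apply Finset.sum_eq_zero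
      intro b _
      rw [if_neg]
      intro hx
      apply hP
      intro k i
      rw [hx]
      simp only [Equiv.symm_apply_apply]
  rw [hbs, Fin.sum_univ_two]
  simp only [Matrix.cons_val_zero, Matrix.cons_val_one]
  rw [← Equiv.sum_comp (finTwoArrowEquiv Bool).symm, Fintype.sum_prod_type, Fintype.sum_bool,
    Fintype.sum_bool, Fintype.sum_bool]
  simp only [finTwoArrowEquiv_symm_apply, smul_add, smul_smul, pow_two]
  abel

/-- HOW MANY ANNIHILATORS ARE LOAD-BEARING: the crux over the dictionary with `n − 4` (instead of
`n = 4t`) independent annihilators is FALSE — at `(t,K,r) = (2,2,2)` (count `2 · 29 = 58 < 64`) the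
two witnesses `ψ_c = |c c c c⟩ ⊗ |M⟩`, each carrying the four one-mode annihilators of block 0,
combine EXACTLY to `|M⟩⊗|M⟩`, so `1 ≤ C(16,2) · 0` fails. [folklore] -/
theorem flatteningBoundRobust_false_with_four_fewer_annihilators :
    ¬ ∀ t K r : ℕ, r * flatteningDeficiency K (t * 4) < t.choose K * 8 ^ K →
      ∀ (a : Fin r → ℂ) (g : Fin r → QReg (t * 4) → ℂ),
        (∀ i, g i ≠ 0 ∧ ∃ A : Fin (t * 4 - 4) → (Fin (t * 4) × Bool → ℂ), LinearIndependent ℂ A ∧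
          ∀ k, (∑ p : Fin (t * 4) × Bool, A k p • majorana (t * 4) p.1 p.2) *ᵥ g i = 0) →
        (1 : ℝ) ≤ ((t * 8).choose K : ℝ) * normSq (magicMPow t - ∑ i, a i • g i) := by
  intro h
  have hcount : 2 * flatteningDeficiency 2 (2 * 4) < Nat.choose 2 2 * 8 ^ 2 := by decide
  have hg : ∀ i : Fin 2, (![((Real.sqrt 2 : ℂ)⁻¹ • ((basisState (fun w : Fin (2 * 4) => ((![false, false]) : Fin 2 → Bool) (finProdFinEquiv.symm w).1) : QReg (2 * 4) → ℂ) + basisState (fun w : Fin (2 * 4) => ((![false, true]) : Fin 2 → Bool) (finProdFinEquiv.symm w).1))), ((Real.sqrt 2 : ℂ)⁻¹ • ((basisState (fun w : Fin (2 * 4) => ((![true, false]) : Fin 2 → Bool) (finProdFinEquiv.symm w).1) : QReg (2 * 4) → ℂ) + basisState (fun w : Fin (2 * 4) => ((![true, true]) : Fin 2 → Bool) (finProdFinEquiv.symm w).1)))] : Fin 2 → QReg (2 * 4) → ℂ) i ≠ 0 ∧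
      ∃ A : Fin (2 * 4 - 4) → (Fin (2 * 4) × Bool → ℂ), LinearIndependent ℂ A ∧
        ∀ k, (∑ p : Fin (2 * 4) × Bool, A k p • majorana (2 * 4) p.1 p.2) *ᵥ
          (![((Real.sqrt 2 : ℂ)⁻¹ • ((basisState (fun w : Fin (2 * 4) => ((![false, false]) : Fin 2 → Bool) (finProdFinEquiv.symm w).1) : QReg (2 * 4) → ℂ) + basisState (fun w : Fin (2 * 4) => ((![false, true]) : Fin 2 → Bool) (finProdFinEquiv.symm w).1))), ((Real.sqrt 2 : ℂ)⁻¹ • ((basisState (fun w : Fin (2 * 4) => ((![true, false]) : Fin 2 → Bool) (finProdFinEquiv.symm w).1) : QReg (2 * 4) → ℂ) + basisState (fun w : Fin (2 * 4) => ((![true, true]) : Fin 2 → Bool) (finProdFinEquiv.symm w).1)))] : Fin 2 → QReg (2 * 4) → ℂ) i = 0 := by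
    intro i
    fin_cases i
    · exact ⟨witness_ne_zero false, (fun (k : Fin 4) (p : Fin (2 * 4) × Bool) => if p.1 = finProdFinEquiv ((0 : Fin 2), k) then (if p.2 then (if (false : Bool) then -Complex.I else Complex.I) else (1 : ℂ)) else 0), witness_annihilators_linearIndependent false,
        witness_annihilates false⟩
    · exact ⟨witness_ne_zero true, (fun (k : Fin 4) (p : Fin (2 * 4) × Bool) => if p.1 = finProdFinEquiv ((0 : Fin 2), k) then (if p.2 then (if (true : Bool) then -Complex.I else Complex.I) else (1 : ℂ)) else 0), witness_annihilators_linearIndependent true,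
        witness_annihilates true⟩
  have key := h 2 2 2 hcount ![(Real.sqrt 2 : ℂ)⁻¹, (Real.sqrt 2 : ℂ)⁻¹] ![((Real.sqrt 2 : ℂ)⁻¹ • ((basisState (fun w : Fin (2 * 4) => ((![false, false]) : Fin 2 → Bool) (finProdFinEquiv.symm w).1) : QReg (2 * 4) → ℂ) + basisState (fun w : Fin (2 * 4) => ((![false, true]) : Fin 2 → Bool) (finProdFinEquiv.symm w).1))), ((Real.sqrt 2 : ℂ)⁻¹ • ((basisState (fun w : Fin (2 * 4) => ((![true, false]) : Fin 2 → Bool) (finProdFinEquiv.symm w).1) : QReg (2 * 4) → ℂ) + basisState (fun w : Fin (2 * 4) => ((![true, true]) : Fin 2 → Bool) (finProdFinEquiv.symm w).1)))] hg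
  rw [← magicMPow_two_eq_sum_witness, sub_self] at key
  norm_num [normSq] at key

end Summit.QuantumAdvantage.QuantumAdvantage.Theorems.FlatteningBoundRobust.Negative
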